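import Literature.Claims.NS.ClayR3BlowupAlternative
import Literature.Analysis.FluidPDE.NSLocalLerayBackwardUniqueness
import HarnessLib

/-!
# Claim skeleton (D-0090 NS-CLAIMS, C151): Shlygin 2026 — «NAVIER–STOKES EXISTENCE AN[D] SMOOTHNESS:
# Complete Proof»

Typed skeleton of Maximus Shlygin (record creator «Shlygin, Maximus»; no author line printed in the
PDF), *NAVIER–STOKES EXISTENCE AN[D] SMOOTHNESS: Complete Proof*, Zenodo record 18507509
(2026-02-06, file «NAVIER_STOKES_Complete_Proof.pdf», 10 pp., PDF sha16 `0755a727d28f1308`; PDF page =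
file `pNNN`) = bib `Shlygin2026`, text of record of cell `ns-claims` row C151 (census pin
`run/shared/lean/pub/ns-claims/census/texts/Shlygin2026/`, README sha16 `7ae8f079487d6961`; line
numbers `l.N` = lines of the pin's `pages/pNNN.txt`; lit seat's `sources/Shlygin2026/LOCATORS.md`
sha16 `d267a950e1433989`). UNREFEREED CLAIM under adjudication («claimed proof architecture», p.1; «Readers
Contract» p.10: «the author used a cascade of advanced AI models … the final verification of the proof
remains the prerogative of the expert community») — NOTHING in this file asserts a step of the paper:
printed statements are `def … : Prop`; the `theorem`s are kernel compositions of the paper's own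
implications, the Clay identification through the tree's a priori `L^∞` door, and classical facts
PROVED from the tree (Lemma 5.9; the blow-up dichotomy Type I ∨ Type II). Verdict vocabulary is the
refuter's / referee's.

## The claimed statement, as printed (Thm 6.2 p.9 l.30–33)
«Theorem 6.2 (Global regularity). For smooth divergence-free initial data on R³, the Navier–Stokes
solution exists globally and remains smooth.» (Document Passport p.1 l.11–14: «Problem: Navier–Stokes
existence and smoothness in R³. • Scope: global regularity for smooth divergence-free initial data.»;
NODE 1.1 p.2 l.19–27: the system with viscosity `ν`, `f ≡ 0`; NODE 1.2 p.2 l.29–31 «We use smooth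
solutions when available, mild solutions via the Duhamel formula …»; Thm 2.1 p.3 (Kato): data in `L³`.)
Printed proof (p.9 l.34–35): «If a finite-time blowup occurs, it is Type I or Type II. Type I is
excluded by Theorem 2.17, and Type II is excluded by Theorem 6.1.» with blow-up = `limsup ‖u(t)‖_∞ = ∞`
(Def. 2.9 p.4). Two faces are typed: `ClaimedTheorem` (Thm 6.2 literal: EVERY smooth divergence-free
datum, no decay / energy clause printed — WIDER data than Fefferman (4), WEAKER conclusion than (A)
(no energy bound (7)); not on the kernel path to Clay) and `NoBlowup` (what the printed proof argues:
no `L^∞` blow-up for the finite-energy classical solutions from Clay data — token for token the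
a priori bound of the tree's door `ClayVariants.clayR3_regularity_iff_aprioriBound`, hence ⇔ (A):
`clayA_of_noBlowup`, PROVED), plus `ClaimedTheoremClay` (Thm 6.2 on Clay data with (7)) =
`clayR3.Regularity` by `Iff.rfl`-grade projection.

## Architecture of the printed proof and the typed Steps (print order)
§2.1 «External Results (Cited)» p.3: Thm 2.1 (Kato `L³`, [1]; TRUE, not typed — the class below is
the finite-energy classical class the tree's door speaks of), Thm 2.2 (ESS, [2]; TRUE, not used by
the chain as typed), **Thm 2.3 + Lemma 2.4** (Type II ⇒ a nontrivial ADMISSIBLE ancient mild solution,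
bounded or with critical growth; `Theorem23_Extraction`), **Thm 2.5** «(Bounded ancient Liouville
theorem). Any bounded smooth ancient mild solution on R³ × (−∞,0] is identically zero. [5]»
(`Theorem25_BoundedLiouville` — typist's flag: FALSE as printed (constants, and every bounded
`b(t)`: tree `isBoundedAncientMildSolution_timeConst`); modulo constants it is the
Koch–Nadirashvili–Seregin–Šverák Liouville problem (L) (KNSS 2009 §1; unsettled in 3-D, tree leaf (L)
of `SelfSimilarLiouville.lean` l.337 and its `Summits/…/Theorems/` twin); it is cited, not proved, and
used by Thm 2.17 AND Thm 6.1), Thm 2.6 (interior regularity [3,4]; TRUE-type, folded into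
§4), **Thm 2.7** (backward uniqueness on `ℝ³ × [t₁,t₂]` for bounded coefficients under Gaussian growth,
[2]; `Theorem27_BackwardUniqueness`, TRUE-type), Lemma 2.8 (trivial). §2.2 p.4: Def 2.9/2.10
(`BlowsUp`, `IsTypeI`), Lemmas 2.11–2.15, **Thm 2.16** (Type I ⇒ bounded ancient limit with
`|ũ(0,0)| = 1`; `Theorem216_BoundedAncientLimit`, TRUE-type: compactness), **Thm 2.17** (Type I
impossible; `TypeIExcluded`; PROVED from 2.16 + 2.5: `typeIExcluded_of`). §3 p.4–5: NODE 3.1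
«admissible» (`Admissible`), NODE 3.2 «critical growth» (tree `HasTypeITimeDecay`), NODE 3.3/3.4
(route). §4 p.5–6: Lemma 4.1 / Cor 4.2 / Lemma 4.3 (`Lemma43_FiniteIntervalBounds`, TRUE-type given
Thm 2.6), Lemma 4.4 (algebra). §5 p.6–9: NODE 5.2 **Thm 5.1** heat Carleman (`Theorem51_HeatCarleman`),
**Thm 5.2** absorption (`Theorem52_Carleman`), Lemma 5.3/5.4 (commutators; TRUE algebra, not typed
separately), Lemma 5.5 (Gaussian tails; TRUE), **Lemma 5.6** «Carleman forcing lemma»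
(`Lemma56_Forcing` — typist's flag: SUSPICIOUS, its proof gives `F = 0` only near `x₀`),
**Thm 5.7** `ω(·,−1) ≡ 0` (`Theorem57_VorticitySlice`, NODE 5.6), **Thm 5.8** backward-uniqueness
iteration (`Theorem58_Iteration`), **Lemma 5.9** curl-free ∧ div-free ∧ `L³` ⇒ 0 (`Lemma59`, PROVED:
`lemma59_holds`), **Thm 5.10** critical-growth Liouville (`Theorem510_CriticalLiouville`; PROVED from
5.7 + 5.8 + 5.9: `theorem510_of`). §6 p.9: **Thm 6.1** Type II excluded (`TypeIIExcluded`; PROVED from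
2.3/2.4 + 2.5 + 5.10: `typeIIExcluded_of`), **Thm 6.2** (`NoBlowup` PROVED from 2.17 + 6.1:
`noBlowup_of`; `ClaimedTheorem` literal). COMPOSITION: `clayA_of_printed_steps :
Theorem216_BoundedAncientLimit → Theorem25_BoundedLiouville → Theorem23_Extraction →
Theorem57_VorticitySlice → Theorem58_Iteration → clayR3.Regularity` (PROVED; Lemma 5.9 consumed as a
theorem). So the distance to Clay (A) sits in `Theorem25_BoundedLiouville` (p.3, first in print, on
BOTH branches) and `Theorem57_VorticitySlice` (NODE 5.6, the Carleman engine, ⇐ 5.1/5.2/5.6).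

**Step index of record (cell TYPING-HYGIENE 11: dependency order = the order the printed proof of
Thm 6.2, p.9 l.34–35, USES the steps = the binder order of `clayA_of_printed_steps`; print order only
breaks ties):** Step 1 = `Theorem216_BoundedAncientLimit` (Thm 2.16 p.4 l.61–65) · Step 2 =
`Theorem25_BoundedLiouville` (Thm 2.5 p.3 l.56–59) · Step 3 = `Theorem23_Extraction` (Thm 2.3 +
Lemma 2.4 p.3 l.28–55) · Step 4 = `Theorem57_VorticitySlice` (Thm 5.7 p.8 l.53–83) · Step 5 =
`Theorem58_Iteration` (Thm 5.8 p.8 l.85–94). Typed non-binders (never the token): `Theorem23_AsCited`,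
`Theorem27_BackwardUniqueness`, `Lemma43_FiniteIntervalBounds`, `Theorem51_HeatCarleman`,
`Theorem52_Carleman`, `Lemma56_Forcing`, `Step57_AnnulusVanishing` (rev 2), `Lemma59` (PROVED).

## Typing conventions (cell TYPING-HYGIENE)
* The solution the printed proof argues about («the Navier–Stokes solution», blow-up Def 2.9 via
  `‖u(t)‖_{L^∞}`) is typed in the a priori form of the tree's Clay doors: a finite-energy classical
  solution `IsClassicalNSSolutionOn (Ico 0 T) ν 0 u p` from a Clay datum (smooth, divergence free,
  Fefferman decay (4)); `BlowsUp u T` = «`‖u(t)‖_∞` unbounded on `[0,T)`» (Def 2.9), `IsTypeI u T`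
  (Def 2.10). This is the class in which Type I/II and the extraction are meaningful; the literal
  Thm 6.2 (all smooth divergence-free data) is kept as `ClaimedTheorem`.
* Ancient objects: tree `IsAncientMildSolution ν ũ` / `IsBoundedAncientMildSolution ν ũ` (KNSS class on
  `(−∞,0) × ℝ³`, slices `t < 0`), «critical growth» = tree `HasTypeITimeDecay A ũ`
  (`‖ũ(t,x)‖ ≤ A/√(−t)`), «admissible» = `Admissible` (`L^∞_loc((−∞,0); L³)`), «smooth» = `C^∞`
  slices; «`ũ ≢ 0`» / «`|ũ(0,0)| = 1`» typed as «not identically zero on `t < 0`» (weaker output for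
  the extraction theorems, hence charitable; Thm 2.5 / 5.10 as printed kill any such `ũ`).
* No suprema: `L^∞` bounds are «`∀ x, ‖·‖ ≤ M`»; Carleman integrals are Bochner integrals over
  `ℝ³` and `(−1,0)` of compactly supported smooth integrands (junk-free); Lemma 5.6 carries
  continuity + compact support of `F` and finite measure of `E` so that no junk integral decides it.
* Constants printed as depending on `(ν, β)` / `(ν, β, ‖b‖_∞, ‖C‖_∞)` are quantified in that order.

Cell files: `claims/Shlygin2026/CARD.md` (typist-1 g5; PREDICTION sealed 2026-08-27T10:47:58Z, sha16
e612d2a0b8955525). WHAT THIS IS NOT: not a claim about NS regularity or blow-up; not a claim about any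
author beyond the typed locator.
-/

noncomputable section

open MeasureTheory Set Filter Topology
open scoped ENNReal NNReal ContDiff RealInnerProductSpace Laplacian

namespace Literature.Claims.NS.Shlygin2026

open Literature.Analysis.FluidPDE Literature.Claims.NS.ClayVariants

/-! ## Vocabulary -/

/-- Physical space `ℝ³`. [folklore] -/
abbrev E3 : Type := EuclideanSpace ℝ (Fin 3)

/-- A Clay datum of class (4): smooth, divergence free, rapidly decaying with all derivatives — the
data for which «the Navier–Stokes solution» of Thm 6.2 / Thm 2.1 (Kato, `u₀ ∈ L³`) is the classical
finite-energy solution. [cite: Shlygin2026, Thm 6.2 p.9 l.30–33; Thm 2.1 p.3 l.5–18] [cite: FeffermanClay2006, (4) p.1] -/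
def IsDatum (u₀ : E3 → E3) : Prop :=
  ContDiff ℝ ∞ u₀ ∧ NSWave0.IsDivFree u₀ ∧ HasRapidSpatialDecay u₀

/-- **The class the printed dichotomy runs in**: a classical solution of the unforced system on
`ℝ³ × [0,T)` (NODE 1.1 p.2 l.19–23) from the datum `u₀`, with finite energy on `[0,T)` (the local
solution of Thm 2.1 continued «while `‖u(t)‖_{L³}` remains bounded», p.3 l.16–17).
[cite: Shlygin2026, NODE 1.1 p.2 l.19–27; NODE 1.2 p.2 l.29–31; Thm 2.1 p.3] -/
structure IsSol (ν : ℝ) (u₀ : E3 → E3) (T : ℝ) (u : ℝ → E3 → E3) (p : ℝ → E3 → ℝ) : Prop where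
  datum : IsDatum u₀
  classical : IsClassicalNSSolutionOn (Ico 0 T) ν 0 u p
  initial : u 0 = u₀
  energy : ∃ A : ℝ≥0∞, A < ⊤ ∧ ∀ t ∈ Ico 0 T, ∫⁻ x, ‖u t x‖ₑ ^ 2 ≤ A

/-- **Def. 2.9 (blow-up time) p.4 l.5–6** «u blows up at T* < ∞ if limsup_{t↑T*} ‖u(t)‖_{L∞} = ∞»,
typed for the solution on `[0,T)`: no uniform bound of `|u|` on `[0,T) × ℝ³`.
[cite: Shlygin2026, Def 2.9 p.4 l.5–6] -/
def BlowsUp (u : ℝ → E3 → E3) (T : ℝ) : Prop :=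
  ¬ ∃ M : ℝ, ∀ t ∈ Ico 0 T, ∀ x, ‖u t x‖ ≤ M

/-- **Def. 2.10 (Type I) p.4 l.7–9** «blowup is Type I if ‖u(t)‖_{L∞} ≤ C(T* − t)^{−1/2} for all
t < T*, and Type II otherwise». [cite: Shlygin2026, Def 2.10 p.4 l.7–9] -/
def IsTypeI (u : ℝ → E3 → E3) (T : ℝ) : Prop :=
  ∃ C : ℝ, ∀ t ∈ Ico 0 T, ∀ x, ‖u t x‖ ≤ C / Real.sqrt (T - t)

/-- **NODE 3.1 «admissibility» p.4 l.72–79**: «An ancient mild solution u on R³ × (−∞,0] is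
admissible if u ∈ L^∞_loc((−∞,0]; L³(R³)) and satisfies the mild formulation on each finite interval»
— the `L³` clause (the mild formulation is `IsAncientMildSolution`): on every `[a,0)`, `a < 0`, the
slices are in `L³` with a common bound. [cite: Shlygin2026, NODE 3.1 p.4 l.71–79; Lemma 2.4 p.3 l.35–41] -/
def Admissible (u : ℝ → E3 → E3) : Prop :=
  ∀ a : ℝ, a < 0 → ∃ B : ℝ≥0∞, B < ⊤ ∧ ∀ t : ℝ, a ≤ t → t < 0 →
    MemLp (u t) 3 volume ∧ eLpNorm (u t) 3 volume ≤ B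

/-- The class of §§3–5 («admissible critical-growth mild ancient solution», NODE 4.1 p.5 l.16–17;
«critical growth» NODE 3.2 p.5 l.3–5 = tree `HasTypeITimeDecay`; «smooth on R³ × (−∞,0]» Lemma 4.3
p.6 l.6–8; divergence free as a Navier–Stokes velocity, used in Thm 5.10's proof p.9 l.19–20).
[cite: Shlygin2026, NODE 3.1–3.2 p.4–5; NODE 4.1 p.5 l.16–17; Lemma 4.3 p.6 l.6–8] -/
structure IsACG (ν : ℝ) (u : ℝ → E3 → E3) : Prop where
  ancient : IsAncientMildSolution ν u
  admissible : Admissible u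
  critical : ∃ A : ℝ, HasTypeITimeDecay A u
  smooth : ∀ t : ℝ, t < 0 → ContDiff ℝ ∞ (u t)
  divFree : ∀ t : ℝ, t < 0 → VectorCalculus.IsDivFree (u t)

/-- «`ũ` nontrivial» («|ũ(0,0)| = 1», Thm 2.3 p.3 l.30 / Thm 2.16 p.4 l.64): not identically zero on
`t < 0` (the tree's ancient solutions live on `(−∞,0)`; by continuity the printed normalisation at
`(0,0)` gives this). [cite: Shlygin2026, Thm 2.3 p.3 l.28–33; Thm 2.16 p.4 l.61–64] -/
def IsNontrivialAncient (u : ℝ → E3 → E3) : Prop :=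
  ¬ ∀ t : ℝ, t < 0 → ∀ x, u t x = 0

/-! ## The claimed statement -/

/-- **CLAIMED THEOREM = Thm 6.2 p.9 l.30–33, literal**: «For smooth divergence-free initial data on
R³, the Navier–Stokes solution exists globally and remains smooth» — for every `ν > 0` and EVERY
smooth divergence-free `u₀` (no decay, integrability or energy clause is printed: Δ4 WIDER than
Fefferman (4); the conclusion carries no energy bound (7): Δ5), a smooth global solution `(u,p)` on
`ℝ³ × [0,∞)` of the unforced system with `u(0) = u₀`. Not on the kernel path to Clay (A) (no (7));
the operative face is `NoBlowup`. [claim: Shlygin2026, status: under-review] [cite: Shlygin2026, Thm 6.2 p.9 l.30–33; Passport p.1 l.11–14] -/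
def ClaimedTheorem : Prop :=
  ∀ ν : ℝ, 0 < ν → ∀ u₀ : E3 → E3, ContDiff ℝ ∞ u₀ → NSWave0.IsDivFree u₀ →
    ∃ (u : ℝ → E3 → E3) (p : ℝ → E3 → ℝ),
      IsSmoothOnHalfSpace u ∧ IsSmoothOnHalfSpace p ∧ IsNavierStokesSolution ν 0 u₀ u p

/-- **Thm 6.2 restricted to Clay data, in Clay's sense** (smooth global solution with bounded energy
(7)): token for token `ClayVariants.clayR3.Regularity` (A). [claim: Shlygin2026, status: under-review] [cite: Shlygin2026, Thm 6.2 p.9 l.30–33] [cite: FeffermanClay2006, (A) p.2] -/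
def ClaimedTheoremClay : Prop :=
  ∀ ν : ℝ, 0 < ν → ∀ u₀ : E3 → E3, IsDatum u₀ → clayR3.Solvable ν 0 u₀

/-- **What the printed proof of Thm 6.2 argues (p.9 l.34–35 with Def 2.9 p.4): NO FINITE-TIME
BLOW-UP** — every solution of the class on a slab `[0,T)` has `|u|` bounded on `[0,T) × ℝ³`. This is
the right-hand side of the tree's door `clayR3_regularity_iff_aprioriBound`, i.e. ⇔ Clay (A).
[claim: Shlygin2026, status: under-review] [cite: Shlygin2026, Thm 6.2 proof p.9 l.34–35; Def 2.9 p.4 l.5–6] -/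
def NoBlowup : Prop :=
  ∀ ν : ℝ, 0 < ν → ∀ (u₀ : E3 → E3) (T : ℝ) (u : ℝ → E3 → E3) (p : ℝ → E3 → ℝ),
    IsSol ν u₀ T u p → ∃ M : ℝ, ∀ t ∈ Ico 0 T, ∀ x, ‖u t x‖ ≤ M

/-! ## The Steps of the printed argument -/

/-- **Thm 2.3 p.3 l.28–34, as cited ([6] «Seregin–Šverák, series of works 2009–2017»)** «(Ancient
solution extraction from Type II blowup). If Type II blowup occurs, one can extract a nontrivial
ancient mild solution ũ : R³ × (−∞,0] → R³ with |ũ(0,0)| = 1 and the alternative: either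
sup_{t≤0} ‖ũ(t)‖_{L∞} < ∞ or ‖ũ(t)‖_{L∞} ≤ A(−t)^{−1/2} for all t < 0.» Typed for the class: a Type II
blow-up of a solution from a Clay datum yields a smooth, divergence-free, nontrivial ancient mild
solution which is bounded or has critical growth (tree `HasTypeITimeDecay`). Typist's flag: the
printed «alternative» (bounded OR critical growth, nothing else) is the non-classical part of this
cited input. [claim: Shlygin2026, status: under-review] [cite: Shlygin2026, Thm 2.3 p.3 l.28–34; References [6] p.10 l.37–38] -/
def Theorem23_AsCited : Prop :=
  ∀ ν : ℝ, 0 < ν → ∀ (u₀ : E3 → E3) (T : ℝ) (u : ℝ → E3 → E3) (p : ℝ → E3 → ℝ),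
    IsSol ν u₀ T u p → BlowsUp u T → ¬ IsTypeI u T →
      ∃ w : ℝ → E3 → E3, IsAncientMildSolution ν w ∧
        (∀ t : ℝ, t < 0 → ContDiff ℝ ∞ (w t)) ∧ (∀ t : ℝ, t < 0 → VectorCalculus.IsDivFree (w t)) ∧
        IsNontrivialAncient w ∧ (IsBoundedOn (Iio 0) w ∨ ∃ A : ℝ, HasTypeITimeDecay A w)

/-- **Thm 2.3 + Lemma 2.4 p.3 l.28–55 — the ADMISSIBLE extraction used by Thm 6.1** (Lemma 2.4
«Admissibility inheritance in the Type II extraction»: «In Theorem 2.3, the extracted ancient mild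
solution ũ can be chosen to satisfy ũ ∈ L^∞_loc((−∞,0]; L³(R³))», four-line proof l.42–55: «the
rescaled sequence carries a uniform L^∞_t L³_x bound inherited from the original solution class»).
Typed: as `Theorem23_AsCited` with, in addition, `Admissible w`. Typist's flag: the inheritance
presupposes an `L^∞_t L³_x` bound on the ORIGINAL solution up to the blow-up time (the
Escauriaza–Seregin–Šverák hypothesis), which the class does not carry. [claim: Shlygin2026, status: under-review] [cite: Shlygin2026, Thm 2.3 p.3 l.28–34; Lemma 2.4 p.3 l.35–55] -/
def Theorem23_Extraction : Prop :=
  ∀ ν : ℝ, 0 < ν → ∀ (u₀ : E3 → E3) (T : ℝ) (u : ℝ → E3 → E3) (p : ℝ → E3 → ℝ),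
    IsSol ν u₀ T u p → BlowsUp u T → ¬ IsTypeI u T →
      ∃ w : ℝ → E3 → E3, IsAncientMildSolution ν w ∧ Admissible w ∧
        (∀ t : ℝ, t < 0 → ContDiff ℝ ∞ (w t)) ∧ (∀ t : ℝ, t < 0 → VectorCalculus.IsDivFree (w t)) ∧
        IsNontrivialAncient w ∧ (IsBoundedOn (Iio 0) w ∨ ∃ A : ℝ, HasTypeITimeDecay A w)

/-- **Thm 2.5 p.3 l.56–59 (cited [5]: «G. A. Seregin, Liouville type theorems for ancient solutions
to the Navier–Stokes equations. Preprint (2018)») — AS PRINTED**: «(Bounded ancient Liouville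
theorem). Any bounded smooth ancient mild solution on R³ × (−∞,0] is identically zero.» Used by
Thm 2.17 (Type I) and Thm 6.1 (bounded branch). Typist's flags: (i) FALSE as printed — constant
fields, and every spatially constant bounded `b(t)`, are bounded smooth ancient mild solutions (tree:
`isBoundedAncientMildSolution_timeConst`, `AncientMildDrift.lean`); (ii) modulo constants («… is
constant») the statement is the Koch–Nadirashvili–Seregin–Šverák Liouville problem (L) (Acta Math. 203
(2009) §1; unsettled in 3-D; the tree's leaf (L) in `SelfSimilarLiouville.lean` l.337 and its
`Summits/…/Theorems/` twin), settled only in special classes (2-D, axisymmetric without swirl,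
`L^∞_t L³_x`) — and in that form `|ũ(0,0)| = 1` no longer yields a contradiction. [claim: Shlygin2026, status: under-review] [cite: Shlygin2026, Thm 2.5 p.3 l.56–59; References [5] p.10 l.35–36] -/
def Theorem25_BoundedLiouville : Prop :=
  ∀ ν : ℝ, 0 < ν → ∀ w : ℝ → E3 → E3, IsBoundedAncientMildSolution ν w →
    (∀ t : ℝ, t < 0 → ContDiff ℝ ∞ (w t)) → ∀ t : ℝ, t < 0 → ∀ x, w t x = 0

/-- **Thm 2.7 p.3 l.63–73 (cited [2]) — backward uniqueness on finite intervals**: «Consider on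
R³ × [t₁,t₂] the linear system ∂ₜv − νΔv + b·∇v + cv = 0, with b ∈ L^∞ and c ∈ L^∞ and t₂ − t₁ < ∞.
Assume Gaussian growth: |v(x,t)| ≤ C_a e^{a|x|²} for all (x,t). If v(·,t₂) = 0 then v ≡ 0 on
R³ × [t₁,t₂].» Typed for classical (`C^{1,2}`) vector solutions with bounded continuous coefficients
(`c` matrix-valued acting on `v`) and the one-sided time derivative within `[t₁,t₂]`. TRUE-type
(typist's flag; backward uniqueness in the whole space under Gaussian growth is classical).
[claim: Shlygin2026, status: under-review] [cite: Shlygin2026, Thm 2.7 p.3 l.63–73] -/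
def Theorem27_BackwardUniqueness : Prop :=
  ∀ (ν : ℝ), 0 < ν → ∀ (t₁ t₂ : ℝ), t₁ < t₂ →
    ∀ (v : ℝ → E3 → E3) (b : ℝ → E3 → E3) (c : ℝ → E3 → E3 →L[ℝ] E3),
      ContDiffOn ℝ 2 (Function.uncurry v) (Icc t₁ t₂ ×ˢ univ) →
      (∃ K : ℝ, ∀ t ∈ Icc t₁ t₂, ∀ x, ‖b t x‖ ≤ K ∧ ‖c t x‖ ≤ K) →
      (∃ a Ca : ℝ, ∀ t ∈ Icc t₁ t₂, ∀ x, ‖v t x‖ ≤ Ca * Real.exp (a * ‖x‖ ^ 2)) →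
      (∀ t ∈ Icc t₁ t₂, ∀ x,
        timeDerivWithin (Icc t₁ t₂) v t x - ν • Δ (v t) x + fderiv ℝ (v t) x (b t x) + c t x (v t x) = 0) →
      (∀ x, v t₂ x = 0) → ∀ t ∈ Icc t₁ t₂, ∀ x, v t x = 0

/-- **Thm 2.16 p.4 l.61–65 — bounded ancient limit under Type I** «Under Type I, a subsequence
converges in C^∞_loc(R³ × (−∞,0]) to a bounded ancient solution ũ with |ũ(0,0)| = 1» (from Lemmas
2.11–2.15 p.4: blow-up sequence, rescaling `λₙ = Mₙ`, normalisation, uniform `L^∞` and derivative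
bounds, Arzelà–Ascoli). Typed output: a smooth nontrivial BOUNDED ancient MILD solution (mild: the
limit of rescaled classical solutions; the use in Thm 2.17 needs «mild» for Thm 2.5). TRUE-type
(typist's flag: compactness + the KNSS limit procedure). [claim: Shlygin2026, status: under-review] [cite: Shlygin2026, Lemmas 2.11–2.15, Thm 2.16 p.4 l.10–65] -/
def Theorem216_BoundedAncientLimit : Prop :=
  ∀ ν : ℝ, 0 < ν → ∀ (u₀ : E3 → E3) (T : ℝ) (u : ℝ → E3 → E3) (p : ℝ → E3 → ℝ),
    IsSol ν u₀ T u p → BlowsUp u T → IsTypeI u T →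
      ∃ w : ℝ → E3 → E3, IsBoundedAncientMildSolution ν w ∧
        (∀ t : ℝ, t < 0 → ContDiff ℝ ∞ (w t)) ∧ IsNontrivialAncient w

/-- **Thm 2.17 p.4 l.66–68 — «Type I blowup cannot occur»** (in the class).
[claim: Shlygin2026, status: under-review] [cite: Shlygin2026, Thm 2.17 p.4 l.66–68] -/
def TypeIExcluded : Prop :=
  ∀ ν : ℝ, 0 < ν → ∀ (u₀ : E3 → E3) (T : ℝ) (u : ℝ → E3 → E3) (p : ℝ → E3 → ℝ),
    IsSol ν u₀ T u p → BlowsUp u T → ¬ IsTypeI u T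

/-- **Lemma 4.3 p.6 l.6–18 (with Lemma 4.1 / Cor 4.2 p.5 via Thm 2.6)** «Assume u satisfies the
critical growth bound and is smooth on R³ × (−∞,0]. Fix t₁ < t₂ ≤ 0 with t₂ < 0. Then for each
k ≥ 0, sup_{R³×[t₁,t₂]} |∇ᵏu| < ∞.» Typed for the class `IsACG` at every order `k`. TRUE-type
(typist's flag: interior parabolic regularity for mild solutions bounded on the slab).
[claim: Shlygin2026, status: under-review] [cite: Shlygin2026, Lemma 4.1 p.5 l.19–49; Cor 4.2 p.5 l.50–60; Lemma 4.3 p.6 l.6–18] -/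
def Lemma43_FiniteIntervalBounds : Prop :=
  ∀ ν : ℝ, 0 < ν → ∀ w : ℝ → E3 → E3, IsACG ν w →
    ∀ t₁ t₂ : ℝ, t₁ < t₂ → t₂ < 0 → ∀ k : ℕ,
      ∃ K : ℝ, ∀ t ∈ Icc t₁ t₂, ∀ x, ‖iteratedFDeriv ℝ k (w t) x‖ ≤ K

/-- The Carleman weight of NODE 5.2 p.6 l.39–48: `φ_{x₀}(x,t) = |x − x₀|²/(4ν(τ − t)) + β log(τ − t)`,
`w = e^{λφ}`. [cite: Shlygin2026, NODE 5.2 p.6 l.39–48] -/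
def carlemanWeight (ν β τ lam : ℝ) (x₀ : E3) (x : E3) (t : ℝ) : ℝ :=
  Real.exp (lam * (‖x - x₀‖ ^ 2 / (4 * ν * (τ - t)) + β * Real.log (τ - t)))

/-- **Thm 5.1 p.7 l.1–28 — heat Carleman estimate** «There exist λ₀ = λ₀(ν,β) > 0 and C = C(ν,β) > 0
such that for all λ ≥ λ₀ and all η ∈ C_c^∞(R³ × (−1,0)),
∬ (λ³/(τ−t)³ |η|² + λ/(τ−t) |∇η|²) w² ≤ C ∬ |(∂ₜ − νΔ)η|² w²» (τ > 1 and x₀ arbitrary, NODE 5.2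
p.6 l.41). Typed for scalar `η : ℝ³ → ℝ → ℝ` (the vector case is componentwise), smooth with compact
support inside `ℝ³ × (−1,0)`; constants uniform in `τ > 1` and `x₀` as printed. Typist's flag:
suspicious (uniformity in `τ`, whole-space weight with compactly supported `η` — refuter's probe by
explicit Gaussians). [claim: Shlygin2026, status: under-review] [cite: Shlygin2026, Thm 5.1 p.7 l.1–42; NODE 5.2 p.6 l.34–48] -/
def Theorem51_HeatCarleman : Prop :=
  ∀ ν β : ℝ, 0 < ν → 0 < β → ∃ lam₀ C : ℝ, 0 < lam₀ ∧ 0 < C ∧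
    ∀ lam : ℝ, lam₀ ≤ lam → ∀ τ : ℝ, 1 < τ → ∀ x₀ : E3, ∀ η : E3 → ℝ → ℝ,
      ContDiff ℝ ∞ (Function.uncurry η) → HasCompactSupport (Function.uncurry η) →
      tsupport (Function.uncurry η) ⊆ univ ×ˢ Ioo (-1) 0 →
        (∫ t in Ioo (-1 : ℝ) 0, ∫ x,
            (lam ^ 3 / (τ - t) ^ 3 * η x t ^ 2 + lam / (τ - t) * ‖gradient (fun y => η y t) x‖ ^ 2) *
              carlemanWeight ν β τ lam x₀ x t ^ 2) ≤
          C * ∫ t in Ioo (-1 : ℝ) 0, ∫ x,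
            (deriv (fun s => η x s) t - ν * Δ (fun y => η y t) x) ^ 2 *
              carlemanWeight ν β τ lam x₀ x t ^ 2

/-- **Thm 5.2 p.7 l.47–83 — Carleman with bounded drift and zeroth order** «Let b ∈ L^∞, C ∈ L^∞.
Then there exist λ₀ = λ₀(ν,β,‖b‖_∞,‖C‖_∞) ≥ 1 and C̃ = C̃(ν,β) such that for all λ ≥ λ₀ and all
η ∈ C_c^∞(R³ × (−1,0)): ∬ (λ³/(τ−t)³|η|² + λ/(τ−t)|∇η|²) w² ≤ C̃ ∬ |(∂ₜ − νΔ + b·∇ + C)η|² w²».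
Scalar `η`, continuous bounded coefficients `b`, `c`. [claim: Shlygin2026, status: under-review] [cite: Shlygin2026, Thm 5.2 p.7 l.47–83] -/
def Theorem52_Carleman : Prop :=
  ∀ ν β K : ℝ, 0 < ν → 0 < β → 0 ≤ K → ∃ lam₀ C : ℝ, 1 ≤ lam₀ ∧ 0 < C ∧
    ∀ lam : ℝ, lam₀ ≤ lam → ∀ τ : ℝ, 1 < τ → ∀ x₀ : E3,
      ∀ (b : E3 → ℝ → E3) (c : E3 → ℝ → ℝ), Continuous (Function.uncurry b) →
        Continuous (Function.uncurry c) → (∀ x t, ‖b x t‖ ≤ K ∧ |c x t| ≤ K) →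
      ∀ η : E3 → ℝ → ℝ, ContDiff ℝ ∞ (Function.uncurry η) → HasCompactSupport (Function.uncurry η) →
        tsupport (Function.uncurry η) ⊆ univ ×ˢ Ioo (-1) 0 →
          (∫ t in Ioo (-1 : ℝ) 0, ∫ x,
              (lam ^ 3 / (τ - t) ^ 3 * η x t ^ 2 + lam / (τ - t) * ‖gradient (fun y => η y t) x‖ ^ 2) *
                carlemanWeight ν β τ lam x₀ x t ^ 2) ≤
            C * ∫ t in Ioo (-1 : ℝ) 0, ∫ x,
              (deriv (fun s => η x s) t - ν * Δ (fun y => η y t) x +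
                  ⟪b x t, gradient (fun y => η y t) x⟫ + c x t * η x t) ^ 2 *
                carlemanWeight ν β τ lam x₀ x t ^ 2

/-- **Lemma 5.6 p.8 l.33–52 — «Carleman forcing lemma»** «Let Φ be smooth and strictly maximized at
x = x₀ for fixed t⋆ ∈ (−1,0). If for all large λ one has ∫_{R³} F(x) e^{2λΦ(x,t⋆)} dx ≤
C ∬_E e^{2λΦ(x,t)} dx dt with F ≥ 0 and E ⊂ R³ × (−1,0) such that sup_E Φ < sup_x Φ(x,t⋆), then
F ≡ 0.» Typed with `F` continuous and compactly supported and `E` measurable of finite measure (so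
every integral is a genuine number). Typist's flag: SUSPICIOUS — the printed proof («comparing
exponentials gives ∫_{B_r(x₀)} F ≤ C|E|e^{−2λ(δ−c_r)} → 0 for r small, hence F = 0») yields `F = 0`
only on small balls around `x₀`. [claim: Shlygin2026, status: under-review] [cite: Shlygin2026, Lemma 5.6 p.8 l.33–52] -/
def Lemma56_Forcing : Prop :=
  ∀ (Φ : E3 → ℝ → ℝ) (x₀ : E3) (tstar : ℝ), tstar ∈ Ioo (-1 : ℝ) 0 →
    ContDiff ℝ ∞ (Function.uncurry Φ) → (∀ x, x ≠ x₀ → Φ x tstar < Φ x₀ tstar) →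
    ∀ (F : E3 → ℝ) (E : Set (E3 × ℝ)) (C : ℝ), Continuous F → HasCompactSupport F → (∀ x, 0 ≤ F x) →
      MeasurableSet E → volume E < ⊤ → E ⊆ univ ×ˢ Ioo (-1 : ℝ) 0 →
      (∃ s : ℝ, s < Φ x₀ tstar ∧ ∀ z ∈ E, Φ z.1 z.2 ≤ s) →
      (∃ lam₀ : ℝ, ∀ lam : ℝ, lam₀ ≤ lam →
        ∫ x, F x * Real.exp (2 * lam * Φ x tstar) ≤
          C * ∫ z in E, Real.exp (2 * lam * Φ z.1 z.2)) →
      ∀ x, F x = 0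

/-- **Thm 5.7 p.8 l.53–83 (NODE 5.6 «Carleman ⇒ vanishing of ω(·,−1)», p.8 l.2–3)** «Let u be an
admissible critical-growth mild ancient solution and ω = ∇ × u. Then ω(·,−1) ≡ 0 on R³.» («after
time normalization», l.3.) LOAD-BEARING: the printed proof is Thm 5.2 + Lemmas 5.3–5.5 + Lemma 5.6
at `t⋆ = −1 + δ`, `δ ↓ 0`. Typist's flags: (i) p.8 l.58–59 «Lemma 4.3 gives b, C ∈ L^∞ on (−1,0)»
misquotes Lemma 4.3 (p.6 l.6–8: bounds on `[t₁,t₂]` with `t₂ < 0` strictly; critical growth allows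
`‖u(t)‖_∞ ↑ ∞` as `t ↑ 0`); (ii) no decay of `ω` in `x` is available to run a whole-space Carleman
argument to VANISHING (the outline l.78–83 promotes finite-interval bounds to `ω(·,−1+δ) ≡ 0`). [claim: Shlygin2026, status: under-review] [cite: Shlygin2026, Thm 5.7 p.8 l.53–83; NODE 5.6 p.8 l.2–3] -/
def Theorem57_VorticitySlice : Prop :=
  ∀ ν : ℝ, 0 < ν → ∀ w : ℝ → E3 → E3, IsACG ν w → ∀ x, curl (w (-1)) x = 0

/-- **Thm 5.8 p.8 l.85–94 — backward uniqueness iteration** «If ω(·,−1) ≡ 0 on R³, then ω ≡ 0 on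
R³ × (−∞,0]» (for the class: Lemma 4.4 + Lemma 4.3 + Lemma 2.8 + Thm 2.7 on each `[−m,−1]`, then
«smoothness extends this to (−∞,0]»). Typed on the open time-line `t < 0`. Typist's flag: the
extension from `(−∞,−1]` FORWARD to `(−1,0)` is not backward uniqueness («smoothness» does not give
it; forward uniqueness of the linear vorticity equation with the given `u` would) — minor, TRUE-type
overall for the class. [claim: Shlygin2026, status: under-review] [cite: Shlygin2026, Thm 5.8 p.8 l.85–94] -/
def Theorem58_Iteration : Prop :=
  ∀ ν : ℝ, 0 < ν → ∀ w : ℝ → E3 → E3, IsACG ν w → (∀ x, curl (w (-1)) x = 0) →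
    ∀ t : ℝ, t < 0 → ∀ x, curl (w t) x = 0

/-- **Lemma 5.9 p.9 l.2–15** «If u(·,t) ∈ L³(R³), div u(·,t) = 0, and ∇ × u(·,t) = 0, then
u(·,t) ≡ 0» (harmonic coordinates in `L³`). Typed for `C²` fields. TRUE (PROVED below from the tree).
[claim: Shlygin2026, status: under-review] [cite: Shlygin2026, Lemma 5.9 p.9 l.2–15] -/
def Lemma59 : Prop :=
  ∀ V : E3 → E3, ContDiff ℝ 2 V → MemLp V 3 volume → VectorCalculus.IsDivFree V →
    (∀ x, curl V x = 0) → V = 0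

/-- **Thm 5.10 p.9 l.17–23 — critical-growth Liouville** «If u is an admissible ancient mild solution
with critical growth, then u ≡ 0.» [claim: Shlygin2026, status: under-review] [cite: Shlygin2026, Thm 5.10 p.9 l.17–23] -/
def Theorem510_CriticalLiouville : Prop :=
  ∀ ν : ℝ, 0 < ν → ∀ w : ℝ → E3 → E3, IsACG ν w → ∀ t : ℝ, t < 0 → ∀ x, w t x = 0

/-- **Thm 6.1 p.9 l.26–28 — «Type II blowup cannot occur»** (in the class): every blow-up is Type I.
[claim: Shlygin2026, status: under-review] [cite: Shlygin2026, Thm 6.1 p.9 l.26–28] -/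
def TypeIIExcluded : Prop :=
  ∀ ν : ℝ, 0 < ν → ∀ (u₀ : E3 → E3) (T : ℝ) (u : ℝ → E3 → E3) (p : ℝ → E3 → ℝ),
    IsSol ν u₀ T u p → BlowsUp u T → IsTypeI u T

/-! ## Kernel relations -/

/-- Thm 2.3 as cited is the admissible extraction with the `L³` clause dropped. [cite: Shlygin2026, Thm 2.3, Lemma 2.4 p.3] -/
theorem theorem23_asCited_of (h : Theorem23_Extraction) : Theorem23_AsCited := by
  intro ν hν u₀ T u p hs hb hI
  obtain ⟨w, hanc, -, hsm, hdiv, hnt, halt⟩ := h ν hν u₀ T u p hs hb hI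
  exact ⟨w, hanc, hsm, hdiv, hnt, halt⟩

/-- **Lemma 5.9 HOLDS (kernel)**: tree `eq_zero_of_curl_eq_zero_of_isDivFree_of_memLp` (curl-free and
divergence-free ⇒ harmonic coordinates; harmonic `L³` functions on `ℝ³` vanish).
[cite: Shlygin2026, Lemma 5.9 p.9 l.2–15] -/
theorem lemma59_holds : Lemma59 :=
  fun _V hV hmem hdiv hcurl => eq_zero_of_curl_eq_zero_of_isDivFree_of_memLp hV hcurl hdiv hmem

/-- **Thm 5.10 from Thm 5.7, Thm 5.8 and Lemma 5.9 — the printed proof p.9 l.19–23 composes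
(kernel)**: `ω(·,−1) = 0` ⇒ `ω ≡ 0` on `t < 0` ⇒ each slice is curl-free, divergence-free and in `L³`
(admissibility) ⇒ zero. [cite: Shlygin2026, Thm 5.10 proof p.9 l.19–23] -/
theorem theorem510_of (h57 : Theorem57_VorticitySlice) (h58 : Theorem58_Iteration) (h59 : Lemma59) :
    Theorem510_CriticalLiouville := by
  intro ν hν w hw t ht x
  have hcurl : ∀ y, curl (w t) y = 0 := h58 ν hν w hw (h57 ν hν w hw) t ht
  obtain ⟨B, -, hB⟩ := hw.admissible t ht
  have hmem : MemLp (w t) 3 volume := (hB t le_rfl ht).1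
  have h0 : w t = 0 := h59 (w t) ((hw.smooth t ht).of_le (by norm_cast)) hmem (hw.divFree t ht) hcurl
  simp [h0]

/-- **Thm 2.17 from Thm 2.16 and Thm 2.5 — the printed proof p.4 l.67–68 composes (kernel)**: a
Type I blow-up gives a nontrivial bounded smooth ancient mild solution, which Thm 2.5 (as printed)
forces to vanish. [cite: Shlygin2026, Thm 2.17 proof p.4 l.67–68] -/
theorem typeIExcluded_of (h216 : Theorem216_BoundedAncientLimit) (h25 : Theorem25_BoundedLiouville) :
    TypeIExcluded := by
  intro ν hν u₀ T u p hs hb hI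
  obtain ⟨w, hw, hsm, hnt⟩ := h216 ν hν u₀ T u p hs hb hI
  exact hnt (h25 ν hν w hw hsm)

/-- **Thm 6.1 from Thm 2.3/Lemma 2.4, Thm 2.5 and Thm 5.10 — the printed proof p.9 l.27–28 composes
(kernel)**: the extracted nontrivial admissible ancient mild solution is bounded (⇒ 0 by Thm 2.5) or
has critical growth (⇒ 0 by Thm 5.10). [cite: Shlygin2026, Thm 6.1 proof p.9 l.27–28] -/
theorem typeIIExcluded_of (h23 : Theorem23_Extraction) (h25 : Theorem25_BoundedLiouville)
    (h510 : Theorem510_CriticalLiouville) : TypeIIExcluded := by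
  intro ν hν u₀ T u p hs hb
  by_contra hI
  obtain ⟨w, hanc, hadm, hsm, hdiv, hnt, halt⟩ := h23 ν hν u₀ T u p hs hb hI
  rcases halt with hbdd | ⟨A, hA⟩
  · exact hnt (h25 ν hν w ⟨hanc, hbdd⟩ hsm)
  · exact hnt (h510 ν hν w ⟨hanc, hadm, ⟨A, hA⟩, hsm, hdiv⟩)

/-- **Thm 6.2's printed proof p.9 l.34–35 composes (kernel)**: a blow-up is Type I or not (Def 2.10);
both are excluded; hence `|u|` is bounded on `[0,T)` (classical logic). [cite: Shlygin2026, Thm 6.2 proof p.9 l.34–35] -/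
theorem noBlowup_of (hI : TypeIExcluded) (hII : TypeIIExcluded) : NoBlowup := by
  intro ν hν u₀ T u p hs
  by_contra hb
  exact hI ν hν u₀ T u p hs hb (hII ν hν u₀ T u p hs hb)

/-- **NO BLOW-UP ⇒ Clay (A)** — the a priori `L^∞` bound for the class IS the hypothesis of the tree's
door `ClayVariants.clayR3_regularity_iff_aprioriBound` (blow-up alternative, Leray 1934 §33 /
Tao 2013 Cor. 11.1). [cite: Shlygin2026, Thm 6.2 p.9] [cite: Leray1934, §33] [cite: Tao2011, Cor. 11.1 (arXiv:1108.1165)] -/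
theorem clayA_of_noBlowup (h : NoBlowup) : clayR3.Regularity :=
  clayR3_regularity_iff_aprioriBound.2 fun ν hν u₀ hsm hdiv hdec T u p hcl hu0 hE =>
    h ν hν u₀ T u p ⟨⟨hsm, hdiv, hdec⟩, hcl, hu0, hE⟩

/-- Conversely Clay (A) gives the a priori bound (the door is an equivalence), so `NoBlowup` is
EXACTLY summit-strength. [cite: FeffermanClay2006, (A) p.2] -/
theorem noBlowup_of_clayA (h : clayR3.Regularity) : NoBlowup :=
  fun ν hν u₀ T u p hs =>
    clayR3_regularity_iff_aprioriBound.1 h ν hν u₀ hs.datum.1 hs.datum.2.1 hs.datum.2.2 T u p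
      hs.classical hs.initial hs.energy

/-- **CLAY LINK for the Clay-restricted face (PROVED)**: `ClaimedTheoremClay` is `clayR3.Regularity`
unfolded. [cite: Shlygin2026, Thm 6.2 p.9 l.30–33] [cite: FeffermanClay2006, (A) p.2] -/
theorem clay_of_claimedClay (h : ClaimedTheoremClay) : clayR3.Regularity :=
  fun ν hν u₀ hsm hdiv hdec => h ν hν u₀ ⟨hsm, hdiv, hdec⟩

/-- … and back. [cite: FeffermanClay2006, (A) p.2] -/
theorem claimedClay_of_clayA (h : clayR3.Regularity) : ClaimedTheoremClay :=
  fun ν hν u₀ hu₀ => h ν hν u₀ hu₀.1 hu₀.2.1 hu₀.2.2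

/-- The literal Thm 6.2 restricted to Clay data follows from the chain's output (the Clay solution is a
smooth global solution; drop the energy clause). [cite: Shlygin2026, Thm 6.2 p.9 l.30–33] -/
theorem claimed_on_clayData_of_noBlowup (h : NoBlowup) :
    ∀ ν : ℝ, 0 < ν → ∀ u₀ : E3 → E3, IsDatum u₀ →
      ∃ (u : ℝ → E3 → E3) (p : ℝ → E3 → ℝ),
        IsSmoothOnHalfSpace u ∧ IsSmoothOnHalfSpace p ∧ IsNavierStokesSolution ν 0 u₀ u p := by
  intro ν hν u₀ hu₀
  obtain ⟨u, p, hu, hp, hns, -⟩ := clayA_of_noBlowup h ν hν u₀ hu₀.1 hu₀.2.1 hu₀.2.2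
  exact ⟨u, p, hu, hp, hns⟩

/-- **COMPOSITION OF THE PRINTED CHAIN (PROVED)** — Remark/Register p.9 l.40–p.10 l.3: Type I via
Thm 2.16 + Thm 2.5; Type II via Thm 2.3/2.4 + Thm 2.5 + Thm 5.10 (= Thm 5.7 + Thm 5.8 + Lemma 5.9, the
last a theorem); no blow-up; Clay (A) by the door. Every premise is a printed step; the kernel
certifies only the logic. [cite: Shlygin2026, Appendix: Claim Register p.9 l.40–p.10 l.3] -/
theorem clayA_of_printed_steps (h216 : Theorem216_BoundedAncientLimit) (h25 : Theorem25_BoundedLiouville)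
    (h23 : Theorem23_Extraction) (h57 : Theorem57_VorticitySlice) (h58 : Theorem58_Iteration) :
    clayR3.Regularity :=
  clayA_of_noBlowup (noBlowup_of (typeIExcluded_of h216 h25)
    (typeIIExcluded_of h23 h25 (theorem510_of h57 h58 lemma59_holds)))

/-- The same chain to the paper's operative statement `NoBlowup` and to `ClaimedTheoremClay`.
[cite: Shlygin2026, Thm 6.2 p.9] -/
theorem claimedClay_of_printed_steps (h216 : Theorem216_BoundedAncientLimit)
    (h25 : Theorem25_BoundedLiouville) (h23 : Theorem23_Extraction) (h57 : Theorem57_VorticitySlice)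
    (h58 : Theorem58_Iteration) : ClaimedTheoremClay :=
  claimedClay_of_clayA (clayA_of_printed_steps h216 h25 h23 h57 h58)


/-! ## Rev 2 (typist-1 g5, append-only; every rev-1 declaration above is byte-identical): the display
grain of Thm 5.7's proof, pre-registered by the REF (ref-3 g6 RETYPE v0 K4, 11:04:12Z) -/

/-- The spatial annulus `Ann_R(x₀) = B_{2R}(x₀) \ B_R(x₀)` of Lemma 5.4 p.7 l.120 (closed version).
[cite: Shlygin2026, Lemma 5.4 p.7 l.103–121] -/
def annulus (x₀ : E3) (R : ℝ) : Set E3 := {x | R ≤ ‖x - x₀‖ ∧ ‖x - x₀‖ ≤ 2 * R}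

/-- **Thm 5.7, proof p.8 l.78–82 — the annulus display AS USED**: «Lemma 5.4 bounds the RHS by terms
supported in supp(ψ′) plus annulus terms. Using Lemma 5.5 and boundedness of ω, ∇ω on [−1,0], the
annulus contributions vanish as R → ∞.» The annulus terms of Lemma 5.4 p.7 l.105–119 are
`R⁻² ∬_{Ann_R} |∇ω|² w²` and `R⁻⁴ ∬_{Ann_R} |ω|² w²` with the PRINTED weight `w = e^{λφ_{x₀}}`,
`φ_{x₀} = |x−x₀|²/(4ν(τ−t)) + β log(τ−t)` (NODE 5.2 p.6 l.42–48; `carlemanWeight`), and the only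
property of `ω` invoked is boundedness. Typed therefore at that grain: for every bounded continuous
scalar `f` on `ℝ³ × (−1,0)` the zeroth-order annulus term `R⁻⁴ ∫_{(−1,0)} ∫_{Ann_R(x₀)} f² w²` tends
to `0` as `R → ∞` (parameters `ν, β > 0`, `τ > 1`, `λ > 0`, `x₀` arbitrary, as in Thm 5.1/5.2).
Typist's flag (REF K4, lit-4 (5)): the printed weight GROWS like a Gaussian away from `x₀` (it is
minimised at `x₀`), while Lemma 5.5 is about DECAYING Gaussian tails and Lemma 5.6 wants `Φ` strictly
MAXimised at `x₀` — the display is kernel-decidable (refuter's object). Alongside-grade: in print order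
the on-path premises Thm 2.3/2.4/2.5 (p.3) precede §5. [claim: Shlygin2026, status: under-review] [cite: Shlygin2026, Thm 5.7 proof p.8 l.78–82; Lemma 5.4 p.7 l.103–121; NODE 5.2 p.6 l.42–48] -/
def Step57_AnnulusVanishing : Prop :=
  ∀ ν β τ lam : ℝ, 0 < ν → 0 < β → 1 < τ → 0 < lam → ∀ x₀ : E3, ∀ f : E3 → ℝ → ℝ,
    Continuous (Function.uncurry f) → (∃ K : ℝ, ∀ x t, |f x t| ≤ K) →
      Tendsto (fun R : ℝ => (R ^ 4)⁻¹ *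
          ∫ t in Ioo (-1 : ℝ) 0, ∫ x in annulus x₀ R, f x t ^ 2 * carlemanWeight ν β τ lam x₀ x t ^ 2)
        atTop (𝓝 0)

/-- The printed weight is at least `1` on `ℝ³ × (−1,0)` for `τ > 1`, `λ, β, ν > 0` (both summands of
`φ_{x₀}` are nonnegative there) — the elementary fact behind the flag: `w` does not decay.
[cite: Shlygin2026, NODE 5.2 p.6 l.42–48] -/
theorem one_le_carlemanWeight {ν β τ lam : ℝ} (hν : 0 < ν) (hβ : 0 < β) (hτ : 1 < τ) (hlam : 0 < lam)
    (x₀ x : E3) {t : ℝ} (ht : t < 0) : 1 ≤ carlemanWeight ν β τ lam x₀ x t := by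
  unfold carlemanWeight
  have hτt : 1 < τ - t := by linarith
  have h1 : 0 ≤ ‖x - x₀‖ ^ 2 / (4 * ν * (τ - t)) := by positivity
  have h2 : 0 ≤ β * Real.log (τ - t) := mul_nonneg hβ.le (Real.log_nonneg hτt.le)
  exact Real.one_le_exp (mul_nonneg hlam.le (add_nonneg h1 h2))

end Literature.Claims.NS.Shlygin2026

end

-- WHAT THIS IS NOT: not a claim about NS regularity or blow-up; not a claim about any author beyond the
-- typed locator.
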